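import Literature.NumberTheory.Transcendental.ZilberFieldQuasiminimalProofs
import Literature.NumberTheory.Transcendental.ZilberFieldCCP
import HarnessLib

/-!
# Isomorphisms of closures extend: Kirby 2010, Thm 2.1 for strongly exponentially-algebraically
closed fields, and the resulting automorphisms of countable models

J. Kirby, *On quasiminimal excellent classes*, J. Symbolic Logic 75 (2010) 551–564, Thm 2.1
(successor step), in the class of algebraically closed exponential fields with surjective
exponential map which are *strongly exponentially-algebraically closed*
(`Literature.NumberTheory.Transcendental.IsStronglyExpAlgClosed`, Zilber's axiom (SEC)) — the
class containing both Zilber's fields and the countable models `M(F_base)` of Bays–Kirby 2018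
(*Pseudo-exponential maps, variants, and quasiminimality*, Algebra & Number Theory 12 (2018),
Thm 6.9 with Lemma 8.3): an isomorphism of exponential fields `g : ecl(b) ≅ ecl(b')` between the
exponential-algebraic closures of finite tuples, together with `a ↦ a'` for `a ∉ ecl(b)`,
`a' ∉ ecl(b')`, extends to an isomorphism `ecl(b, a) ≅ ecl(b', a')`
(`eclIso_extension_of_isStronglyExpAlgClosed`).

The tree proves this for *Zilber fields* (`IsZilberField.eclIso_extension_holds`,
`ZilberFieldQuasiminimalProofs.lean`); that proof uses of the Zilber axioms only algebraic
closedness, surjectivity of `exp`, strong exponential-algebraic closedness (through generic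
strong Γ-closedness, `ZilberGSGC.isGenericallyStronglyGammaClosedOver_of_isStronglyExpAlgClosed`,
and the twisted `ℵ₀`-saturation of Bays–Kirby Prop. 11.2, `GammaField.isGammaIsoTw_saturation`)
and the countable closure property (only to know that the closures are countable) — neither the
Schanuel property nor the standard kernel. This file records the theorem under exactly those
hypotheses (the proof is the tree's, verbatim), and draws the consequence used for Bays–Kirby's
countable models (Thm 6.9, proof of QM4/QM5a: "since `M` is `𝒞^{fg}`-homogeneous, `θ₀` extends to
an automorphism `θ` of `M`"): in a *countable* such field which is infinite dimensional for `ecl`,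
every isomorphism between closures of finite tuples extends to an automorphism of the
exponential field (`exists_exponentialRingEquiv_of_isEIsoOn`, Kirby 2010 Thm 2.1 / Cor. 2.2 by the
`ω`-back-and-forth `Literature.ModelTheory.Quasiminimal.exists_map_of_backAndForth`).

## References

* J. Kirby, *On quasiminimal excellent classes*, J. Symbolic Logic 75 (2010) 551–564: Thm 2.1,
  Cor. 2.2.
* M. Bays, J. Kirby, *Pseudo-exponential maps, variants, and quasiminimality*, Algebra & Number
  Theory 12 (2018) 493–549: Thm 6.9 (proof), Lemma 8.3, Prop. 11.2.
* B. Zilber, *Pseudo-exponentiation on algebraically closed fields of characteristic zero*,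
  Ann. Pure Appl. Logic 132 (2005): §5.
-/

noncomputable section

open Set MvPolynomial

universe u

namespace Literature.NumberTheory.Transcendental

namespace ZilberHomogeneity

open GammaField Literature.ModelTheory.ExponentialFields.ExponentialRing
  Literature.ModelTheory.Quasiminimal

variable {K : Type u} [Field K] [CharZero K] [Literature.ModelTheory.ExponentialFields.ExponentialRing K]

/-! ### Kirby 2010, Thm 2.1 for strongly exponentially-algebraically closed fields -/

set_option maxHeartbeats 400000 in
/-- **Kirby 2010, Thm 2.1 (successor step) for algebraically closed, strongly
exponentially-algebraically closed exponential fields with surjective `exp` and the countable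
closure property**: for finite tuples `b`, `b'`, an isomorphism of exponential fields
`g : ecl(b) ≅ ecl(b')`, and `a ∉ ecl(b)`, `a' ∉ ecl(b')`, the map `g ∪ {(a, a')}` extends to an
isomorphism of exponential fields `ecl(b, a) ≅ ecl(b', a')`. The proof is that of
`IsZilberField.eclIso_extension_holds` (countable back-and-forth through the covering relation
`Covered` of twisted Γ-isomorphisms over `baseEquiv g`, started at `(a) ↦ (a')` and extended by
`Covered.forth`, i.e. by the twisted `ℵ₀`-saturation from generic strong Γ-closedness), which
uses no other Zilber axiom. [cite: Kirby2010QMEC, Thm 2.1]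
[cite: BaysKirby2018ANT, Thm 6.9 (proof), Prop. 11.2] [cite: Zilber2005PseudoExp, §5] -/
theorem eclIso_extension_of_isStronglyExpAlgClosed [IsAlgClosed K]
    (hsurj : IsSurjectiveOntoUnits K) (hSEAC : IsStronglyExpAlgClosed K)
    (hccp : HasCountableClosureProperty K)
    {m n : ℕ} (b : Fin m → K) (b' : Fin n → K) (g : K → K)
    (hg : IsEIsoOn g (ecl (Set.range b)) (ecl (Set.range b')))
    {a a' : K} (ha : a ∉ ecl (Set.range b)) (ha' : a' ∉ ecl (Set.range b')) :
    ∃ g' : K → K, IsEIsoOn g' (ecl (insert a (Set.range b))) (ecl (insert a' (Set.range b'))) ∧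
      Set.EqOn g' g (ecl (Set.range b)) ∧ g' a = a' := by
  classical
  -- the bases and the closures
  set K₁ : Submodule ℚ K := Submodule.span ℚ (ecl (range b)) with hK₁def
  set K₂ : Submodule ℚ K := Submodule.span ℚ (ecl (range b')) with hK₂def
  set H₁ : Submodule ℚ K := Submodule.span ℚ (ecl (insert a (range b))) with hH₁def
  set H₂ : Submodule ℚ K := Submodule.span ℚ (ecl (insert a' (range b'))) with hH₂def
  have hK₁ : IsGammaClosed K₁ := isGammaClosed_span_ecl_univ _
  have hK₂ : IsGammaClosed K₂ := isGammaClosed_span_ecl_univ _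
  have hH₁ : IsGammaClosed H₁ := isGammaClosed_span_ecl_univ _
  have hH₂ : IsGammaClosed H₂ := isGammaClosed_span_ecl_univ _
  have hG₁ : IsGenericallyStronglyGammaClosedOver K₁ :=
    ZilberGSGC.isGenericallyStronglyGammaClosedOver_of_isStronglyExpAlgClosed hSEAC K₁
  have hG₂ : IsGenericallyStronglyGammaClosedOver K₂ :=
    ZilberGSGC.isGenericallyStronglyGammaClosedOver_of_isStronglyExpAlgClosed hSEAC K₂
  have hmemK₁ : ∀ {z : K}, z ∈ K₁ ↔ z ∈ ecl (range b) := fun {z} => by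
    rw [← SetLike.mem_coe, hK₁def, coe_span_ecl]
  have hmemK₂ : ∀ {z : K}, z ∈ K₂ ↔ z ∈ ecl (range b') := fun {z} => by
    rw [← SetLike.mem_coe, hK₂def, coe_span_ecl]
  have hmemH₁ : ∀ {z : K}, z ∈ H₁ ↔ z ∈ ecl (insert a (range b)) := fun {z} => by
    rw [← SetLike.mem_coe, hH₁def, coe_span_ecl]
  have hmemH₂ : ∀ {z : K}, z ∈ H₂ ↔ z ∈ ecl (insert a' (range b')) := fun {z} => by
    rw [← SetLike.mem_coe, hH₂def, coe_span_ecl]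
  have hKH₁ : K₁ ≤ H₁ := fun z hz => hmemH₁.2 (ecl_mono (subset_insert _ _) (hmemK₁.1 hz))
  have hKH₂ : K₂ ≤ H₂ := fun z hz => hmemH₂.2 (ecl_mono (subset_insert _ _) (hmemK₂.1 hz))
  have haH₁ : a ∈ H₁ := hmemH₁.2 (subset_ecl _ (mem_insert _ _))
  have haH₂ : a' ∈ H₂ := hmemH₂.2 (subset_ecl _ (mem_insert _ _))
  have hHa₁ : (H₁ : Set K) ⊆ ecl (insert a (K₁ : Set K)) := by
    intro z hz
    rw [SetLike.mem_coe, hmemH₁] at hz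
    refine ecl_mono (insert_subset_insert fun w hw => ?_) hz
    rw [SetLike.mem_coe, hmemK₁]; exact subset_ecl _ hw
  have hHa₂ : (H₂ : Set K) ⊆ ecl (insert a' (K₂ : Set K)) := by
    intro z hz
    rw [SetLike.mem_coe, hmemH₂] at hz
    refine ecl_mono (insert_subset_insert fun w hw => ?_) hz
    rw [SetLike.mem_coe, hmemK₂]; exact subset_ecl _ hw
  -- the base isomorphism
  set σ := baseEquiv hg with hσdef
  have hσ : IsEBaseIso K₁ K₂ σ := isEBaseIso_baseEquiv hg
  -- the starting pair `(a) ↦ (a')`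
  have haK₁ : a ∉ K₁ := fun h => ha (hmemK₁.1 h)
  have haK₂ : a' ∉ K₂ := fun h => ha' (hmemK₂.1 h)
  have hstart : Covered σ H₁ H₂ a a' 0 Fin.elim0 Fin.elim0 := by
    have h0 := isGammaIsoTw_elim0 (K := K) σ
    have he0 : range (Fin.elim0 : Fin 0 → K) = ∅ := Set.range_eq_empty _
    have hs₁ : IsStrong (K₁ ⊔ Submodule.span ℚ (range (Fin.elim0 : Fin 0 → K))) := by
      rw [he0, Submodule.span_empty, sup_bot_eq]; exact hK₁.isStrong
    have hs₂ : IsStrong (K₂ ⊔ Submodule.span ℚ (range (Fin.elim0 : Fin 0 → K))) := by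
      rw [he0, Submodule.span_empty, sup_bot_eq]; exact hK₂.isStrong
    obtain ⟨hγ, hst₁, hst₂⟩ := h0.append_singleton_of_not_mem hs₁ hs₂ hK₁ hK₂
      (by rw [he0, Submodule.span_empty, sup_bot_eq])
      (by rw [he0, Submodule.span_empty, sup_bot_eq]) haK₁ haK₂
    refine ⟨0 + 1, Fin.append Fin.elim0 ![a], Fin.append Fin.elim0 ![a'], hγ, hst₁, hst₂,
      fun i => ?_, fun i => ?_, ⟨Fin.natAdd 0 0, by simp, by simp⟩, fun j => j.elim0⟩
    · refine Fin.addCases (fun j => j.elim0) (fun j => ?_) i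
      rw [Fin.append_right, Fin.fin_one_eq_zero j]; exact haH₁
    · refine Fin.addCases (fun j => j.elim0) (fun j => ?_) i
      rw [Fin.append_right, Fin.fin_one_eq_zero j]; exact haH₂
  -- countability
  have hC₁ : ((H₁ : Set K)).Countable := countable_span_ecl hccp ((finite_range b).insert a).countable
  have hC₂ : ((H₂ : Set K)).Countable := countable_span_ecl hccp ((finite_range b').insert a').countable
  -- the back-and-forth
  obtain ⟨g', himg, hcov⟩ := exists_map_of_backAndForth (M := K)
    (S := fun n x y => Covered σ H₁ H₂ a a' n x y) (C := (H₁ : Set K)) (C' := (H₂ : Set K)) hC₁ hC₂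
    hstart (fun n x y h i j => h.apply_eq_iff i j)
    (fun n x y h _ _ d hd => Covered.forth hsurj hσ hK₁ hG₂ hH₁ hH₂ hKH₁ hKH₂ hHa₁ h hd)
    (fun n x y h _ _ d hd => by
      obtain ⟨d₀, hd₀, hcov⟩ := Covered.forth hsurj hσ.symm hK₂ hG₁ hH₂ hH₁ hKH₂ hKH₁ hHa₂ h.symm hd
      refine ⟨d₀, hd₀, ?_⟩
      have := hcov.symm
      rwa [RingEquiv.symm_symm] at this)
  -- extracting a covering pair for finitely many points of `H₁`
  have hpair : ∀ {k : ℕ} (τ : Fin k → K), (∀ i, τ i ∈ H₁) →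
      ∃ (m : ℕ) (c c' : Fin m → K), IsGammaIsoTw σ c c' ∧ (∃ i, c i = a ∧ c' i = a') ∧
        ∀ j, ∃ i, c i = τ j ∧ c' i = g' (τ j) := by
    intro k τ hτ
    obtain ⟨n₀, x, y, hS, -, -, ι, hx, hy⟩ := hcov τ hτ
    obtain ⟨m', c, c', hiso, -, -, -, -, hia, hcv⟩ := hS
    refine ⟨m', c, c', hiso, hia, fun j => ?_⟩
    obtain ⟨i, hi, hi'⟩ := hcv (ι j)
    exact ⟨i, by rw [hi]; exact congrFun hx j, by rw [hi']; exact congrFun hy j⟩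
  -- the closures are E-subfields
  have hHadd : ∀ {u v : K}, u ∈ (H₁ : Set K) → v ∈ (H₁ : Set K) → u + v ∈ (H₁ : Set K) := by
    intro u v hu hv
    rw [SetLike.mem_coe, hmemH₁] at hu hv ⊢
    exact Khovanskii.add_mem_ecl hu hv
  have hHmul : ∀ {u v : K}, u ∈ (H₁ : Set K) → v ∈ (H₁ : Set K) → u * v ∈ (H₁ : Set K) := by
    intro u v hu hv
    rw [SetLike.mem_coe, hmemH₁] at hu hv ⊢
    exact Khovanskii.mul_mem_ecl hu hv
  have hHexp : ∀ {u : K}, u ∈ (H₁ : Set K) → exp u ∈ (H₁ : Set K) := by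
    intro u hu
    rw [SetLike.mem_coe, hmemH₁] at hu ⊢
    exact Khovanskii.exp_mem_ecl hu
  -- conclusion
  have hHset₁ : ((H₁ : Set K)) = ecl (insert a (range b)) := by rw [hH₁def, coe_span_ecl]
  have hHset₂ : ((H₂ : Set K)) = ecl (insert a' (range b')) := by rw [hH₂def, coe_span_ecl]
  refine ⟨g', ?_, ?_, ?_⟩
  · rw [← hHset₁, ← hHset₂]
    refine ⟨⟨?_, ?_, ?_⟩, ?_, ?_, ?_⟩
    · intro z hz
      rw [← himg]; exact mem_image_of_mem g' hz
    · intro p hp q hq hpq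
      obtain ⟨m', c, c', hiso, -, hcv⟩ := hpair ![p, q] (fun i => by fin_cases i <;> assumption)
      obtain ⟨i, hi, hi'⟩ := hcv 0
      obtain ⟨j, hj, hj'⟩ := hcv 1
      simp only [Matrix.cons_val_zero, Matrix.cons_val_one] at hi hi' hj hj'
      have := (hiso.apply_eq_iff i j).2 (by rw [hi', hj', hpq])
      rwa [hi, hj] at this
    · rw [← himg]; exact surjOn_image g' _
    · intro u v hu hv
      obtain ⟨m', c, c', hiso, -, hcv⟩ := hpair ![u, v, u + v]
        (fun i => by fin_cases i <;> [exact hu; exact hv; exact hHadd hu hv])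
      obtain ⟨i, hi, hi'⟩ := hcv 0
      obtain ⟨j, hj, hj'⟩ := hcv 1
      obtain ⟨k, hk, hk'⟩ := hcv 2
      simp only [Matrix.cons_val_zero, Matrix.cons_val_one, Matrix.head_cons, Matrix.cons_val_two,
        Matrix.tail_cons] at hi hi' hj hj' hk hk'
      have := hiso.add_eq (i := i) (j := j) (k := k) (by rw [hi, hj, hk])
      rw [hi', hj', hk'] at this
      exact this.symm
    · intro u v hu hv
      obtain ⟨m', c, c', hiso, -, hcv⟩ := hpair ![u, v, u * v]
        (fun i => by fin_cases i <;> [exact hu; exact hv; exact hHmul hu hv])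
      obtain ⟨i, hi, hi'⟩ := hcv 0
      obtain ⟨j, hj, hj'⟩ := hcv 1
      obtain ⟨k, hk, hk'⟩ := hcv 2
      simp only [Matrix.cons_val_zero, Matrix.cons_val_one, Matrix.head_cons, Matrix.cons_val_two,
        Matrix.tail_cons] at hi hi' hj hj' hk hk'
      have := hiso.mul_eq (i := i) (j := j) (k := k) (by rw [hi, hj, hk])
      rw [hi', hj', hk'] at this
      exact this.symm
    · intro u hu
      obtain ⟨m', c, c', hiso, -, hcv⟩ := hpair ![u, exp u]
        (fun i => by fin_cases i <;> [exact hu; exact hHexp hu])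
      obtain ⟨i, hi, hi'⟩ := hcv 0
      obtain ⟨k, hk, hk'⟩ := hcv 1
      simp only [Matrix.cons_val_zero, Matrix.cons_val_one] at hi hi' hk hk'
      have := hiso.exp_eq (i := i) (k := k) (by rw [hi, hk])
      rw [hi', hk'] at this
      exact this.symm
  · -- `g' = g` on `ecl b`
    intro z hz
    have hzK : z ∈ K₁ := hmemK₁.2 hz
    obtain ⟨m', c, c', hiso, -, hcv⟩ := hpair ![z] (fun i => by fin_cases i; exact hKH₁ hzK)
    obtain ⟨i, hi, hi'⟩ := hcv 0
    simp only [Matrix.cons_val_zero] at hi hi'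
    have hzF : z ∈ fieldOf K₁ := mem_fieldOf_of_mem hzK
    have := hiso.eq_of_eq_coe (i := i) (k := ⟨z, hzF⟩) hi
    rw [hi'] at this
    rw [this, hσdef, coe_baseEquiv]
  · -- `g' a = a'`
    obtain ⟨m', c, c', hiso, ⟨i₀, hi₀, hi₀'⟩, hcv⟩ := hpair ![a] (fun i => by fin_cases i; exact haH₁)
    obtain ⟨i, hi, hi'⟩ := hcv 0
    simp only [Matrix.cons_val_zero] at hi hi'
    have := (hiso.apply_eq_iff i₀ i).1 (by rw [hi₀, hi])
    rw [hi₀', hi'] at this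
    exact this.symm


/-! ### Automorphisms of countable infinite-dimensional models (Kirby 2010, Thm 2.1 / Cor. 2.2) -/

omit [Field K] [CharZero K] [Literature.ModelTheory.ExponentialFields.ExponentialRing K] in
/-- Ranges of appended tuples (re-export for rewriting). [folklore] -/
theorem range_append_eq_union {p q : ℕ} (x : Fin p → K) (y : Fin q → K) :
    range (Fin.append x y) = range x ∪ range y :=
  ZilberHomogeneity.range_append x y

omit [Field K] [CharZero K] [Literature.ModelTheory.ExponentialFields.ExponentialRing K] in
/-- `range (Fin.append b (Fin.snoc x a)) = insert a (range (Fin.append b x))`. [folklore] -/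
theorem range_append_snoc_eq_insert {p q : ℕ} (b : Fin p → K) (x : Fin q → K) (a : K) :
    range (Fin.append b (Fin.snoc x a : Fin (q + 1) → K)) = insert a (range (Fin.append b x)) := by
  rw [range_append_eq_union, range_append_eq_union, Fin.range_snoc, Set.union_insert]

/-- **Isomorphisms between closures of finite tuples extend to automorphisms** (Kirby 2010,
Thm 2.1 with Cor. 2.2, for the countable model; Bays–Kirby 2018, Thm 6.9, proof of QM5a: "since
`M` is `𝒞^{fg}`-homogeneous, `θ₀` extends to an automorphism `θ` of `M`"). Let `K` be a countable,
algebraically closed, strongly exponentially-algebraically closed exponential field with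
surjective `exp` which is infinite dimensional for `ecl` (no finite set has closure `K`). Then
every isomorphism of exponential fields `g : ecl(b) ≅ ecl(b')` between closures of finite tuples
is the restriction of an automorphism of the exponential field `K`. Proof: `ω`-back-and-forth
(`Literature.ModelTheory.Quasiminimal.exists_map_of_backAndForth`) through isomorphisms of
closures of finite tuples extending `g`: an element of the current closure is already covered; an
element outside it is matched with an element outside the closure on the other side (infinite
dimensionality) by `eclIso_extension_of_isStronglyExpAlgClosed`.
[cite: Kirby2010QMEC, Thm 2.1 and Cor. 2.2] [cite: BaysKirby2018ANT, Thm 6.9 (proof)] -/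
theorem exists_exponentialRingEquiv_of_isEIsoOn [IsAlgClosed K] [Countable K]
    (hsurj : IsSurjectiveOntoUnits K) (hSEAC : IsStronglyExpAlgClosed K)
    (hinf : ∀ C : Set K, C.Finite → ∃ d, d ∉ ecl C)
    {m n : ℕ} {b : Fin m → K} {b' : Fin n → K} {g : K → K}
    (hg : IsEIsoOn g (ecl (range b)) (ecl (range b'))) :
    ∃ ρ : ExponentialRingEquiv K K, Set.EqOn ρ g (ecl (range b)) := by
  classical
  have hccp : HasCountableClosureProperty K := HasCountableClosureProperty.of_countable
  -- the back-and-forth relation: isomorphisms of closures extending `g`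
  let S : ∀ k : ℕ, (Fin k → K) → (Fin k → K) → Prop := fun k x y =>
    ∃ h : K → K, IsEIsoOn h (ecl (range (Fin.append b x))) (ecl (range (Fin.append b' y))) ∧
      Set.EqOn h g (ecl (range b)) ∧ ∀ i, h (x i) = y i
  have h0 : S 0 Fin.elim0 Fin.elim0 := by
    refine ⟨g, ?_, fun _ _ => rfl, fun i => i.elim0⟩
    have e1 : range (Fin.append b (Fin.elim0 : Fin 0 → K)) = range b := by
      rw [range_append_eq_union, Set.range_eq_empty Fin.elim0, Set.union_empty]
    have e2 : range (Fin.append b' (Fin.elim0 : Fin 0 → K)) = range b' := by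
      rw [range_append_eq_union, Set.range_eq_empty Fin.elim0, Set.union_empty]
    rw [e1, e2]
    exact hg
  have hsubL : ∀ {k : ℕ} (x : Fin k → K), ecl (range b) ⊆ ecl (range (Fin.append b x)) := fun x =>
    ecl_mono (by rw [range_append_eq_union]; exact subset_union_left)
  have hmemL : ∀ {k : ℕ} (x : Fin k → K) (i : Fin k), x i ∈ ecl (range (Fin.append b x)) :=
    fun x i => subset_ecl _ (by rw [range_append_eq_union]; exact Or.inr ⟨i, rfl⟩)
  have hmemR : ∀ {k : ℕ} (y : Fin k → K) (i : Fin k), y i ∈ ecl (range (Fin.append b' y)) :=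
    fun y i => subset_ecl _ (by rw [range_append_eq_union]; exact Or.inr ⟨i, rfl⟩)
  have hwd : ∀ ⦃k⦄ ⦃x y : Fin k → K⦄, S k x y → ∀ i j, x i = x j ↔ y i = y j := by
    rintro k x y ⟨h, hh, -, hxy⟩ i j
    rw [← hxy i, ← hxy j]
    exact ⟨fun e => by rw [e], fun e => hh.bijOn.injOn (hmemL x i) (hmemL x j) e⟩
  -- forth
  have forth : ∀ ⦃k⦄ ⦃x y : Fin k → K⦄, S k x y → ∀ a : K,
      ∃ c : K, S (k + 1) (Fin.snoc x a) (Fin.snoc y c) := by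
    rintro k x y ⟨h, hh, hhg, hxy⟩ a
    by_cases ha : a ∈ ecl (range (Fin.append b x))
    · refine ⟨h a, h, ?_, hhg, fun i => ?_⟩
      · rw [range_append_snoc_eq_insert, range_append_snoc_eq_insert, ecl_insert_of_mem ha,
          ecl_insert_of_mem (hh.bijOn.mapsTo ha)]
        exact hh
      · refine Fin.lastCases ?_ (fun j => ?_) i
        · simp
        · simp only [Fin.snoc_castSucc]; exact hxy j
    · obtain ⟨c, hc⟩ := hinf _ (finite_range (Fin.append b' y))
      obtain ⟨h', hh', hEq, hha⟩ :=
        eclIso_extension_of_isStronglyExpAlgClosed hsurj hSEAC hccp _ _ h hh ha hc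
      refine ⟨c, h', ?_, fun z hz => ?_, fun i => ?_⟩
      · rw [range_append_snoc_eq_insert, range_append_snoc_eq_insert]
        exact hh'
      · rw [hEq (hsubL x hz)]; exact hhg hz
      · refine Fin.lastCases ?_ (fun j => ?_) i
        · simpa using hha
        · simp only [Fin.snoc_castSucc]
          rw [hEq (hmemL x j)]; exact hxy j
  -- back
  have back : ∀ ⦃k⦄ ⦃x y : Fin k → K⦄, S k x y → ∀ c : K,
      ∃ a : K, S (k + 1) (Fin.snoc x a) (Fin.snoc y c) := by
    rintro k x y ⟨h, hh, hhg, hxy⟩ c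
    by_cases hc : c ∈ ecl (range (Fin.append b' y))
    · set a := Function.invFunOn h (ecl (range (Fin.append b x))) c with ha
      have haL : a ∈ ecl (range (Fin.append b x)) := hh.bijOn.surjOn.mapsTo_invFunOn hc
      have hha : h a = c := hh.bijOn.invOn_invFunOn.2 hc
      refine ⟨a, h, ?_, hhg, fun i => ?_⟩
      · rw [range_append_snoc_eq_insert, range_append_snoc_eq_insert, ecl_insert_of_mem haL,
          ecl_insert_of_mem hc]
        exact hh
      · refine Fin.lastCases ?_ (fun j => ?_) i
        · simpa using hha
        · simp only [Fin.snoc_castSucc]; exact hxy j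
    · obtain ⟨a, ha⟩ := hinf _ (finite_range (Fin.append b x))
      obtain ⟨k', hk', hEq, hkc⟩ :=
        eclIso_extension_of_isStronglyExpAlgClosed hsurj hSEAC hccp _ _ _ hh.symm hc ha
      set h' := Function.invFunOn k' (ecl (insert c (range (Fin.append b' y)))) with hh'def
      have hh' : IsEIsoOn h' (ecl (insert a (range (Fin.append b x))))
          (ecl (insert c (range (Fin.append b' y)))) := hk'.symm
      -- `h'` extends `h`
      have hext : Set.EqOn h' h (ecl (range (Fin.append b x))) := by
        intro z hz
        have hz' : h z ∈ ecl (range (Fin.append b' y)) := hh.bijOn.mapsTo hz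
        have h1 : k' (h z) = z := by rw [hEq hz']; exact hh.symm_apply_apply hz
        have h2 : h' (k' (h z)) = h z :=
          hk'.symm_apply_apply (ecl_mono (Set.subset_insert _ _) hz')
        rw [h1] at h2
        exact h2
      have hha : h' a = c := by
        have := hk'.symm_apply_apply (subset_ecl _ (Set.mem_insert c _))
        rw [hkc] at this
        exact this
      refine ⟨a, h', ?_, fun z hz => ?_, fun i => ?_⟩
      · rw [range_append_snoc_eq_insert, range_append_snoc_eq_insert]
        exact hh'
      · rw [hext (hsubL x hz)]; exact hhg hz
      · refine Fin.lastCases ?_ (fun j => ?_) i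
        · simpa using hha
        · simp only [Fin.snoc_castSucc]
          rw [hext (hmemL x j)]; exact hxy j
  -- run the back-and-forth through all of `K`
  obtain ⟨G, himg, hcov⟩ := exists_map_of_backAndForth (M := K) (S := S) (C := (univ : Set K))
    (C' := (univ : Set K)) countable_univ countable_univ h0 hwd
    (fun k x y hS _ _ a _ => let ⟨c, hc⟩ := forth hS a; ⟨c, mem_univ _, hc⟩)
    (fun k x y hS _ _ c _ => let ⟨a, ha⟩ := back hS c; ⟨a, mem_univ _, ha⟩)
  -- every finite tuple is covered by an isomorphism of closures extending `g` and agreeing with `G`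
  have hpair : ∀ {p : ℕ} (σ : Fin p → K), ∃ (h : K → K) (T T' : Set K),
      IsEIsoOn h (ecl T) (ecl T') ∧ Set.EqOn h g (ecl (range b)) ∧ ecl (range b) ⊆ ecl T ∧
        (∀ j, σ j ∈ ecl T) ∧ ∀ j, h (σ j) = G (σ j) := by
    intro p σ
    obtain ⟨k, x, y, ⟨h, hh, hhg, hxy⟩, -, -, ι, hx, hy⟩ := hcov σ (fun _ => mem_univ _)
    refine ⟨h, _, _, hh, hhg, hsubL x, fun j => ?_, fun j => ?_⟩
    · rw [← congrFun hx j]; exact hmemL x (ι j)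
    · have h1 := congrFun hx j
      have h2 := congrFun hy j
      simp only [Function.comp_apply] at h1 h2
      rw [← h1, hxy, h2, h1]
  -- `G` is an automorphism of the exponential field
  have hadd : ∀ u v, G (u + v) = G u + G v := by
    intro u v
    obtain ⟨h, T, T', hh, -, -, hmem, hG⟩ := hpair ![u, v, u + v]
    have h0 := hG 0; have h1 := hG 1; have h2 := hG 2
    simp only [Matrix.cons_val_zero, Matrix.cons_val_one, Matrix.head_cons, Matrix.cons_val_two,
      Matrix.tail_cons] at h0 h1 h2
    have hu := hmem 0; have hv := hmem 1
    simp only [Matrix.cons_val_zero, Matrix.cons_val_one] at hu hv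
    rw [← h2, hh.map_add hu hv, h0, h1]
  have hmul : ∀ u v, G (u * v) = G u * G v := by
    intro u v
    obtain ⟨h, T, T', hh, -, -, hmem, hG⟩ := hpair ![u, v, u * v]
    have h0 := hG 0; have h1 := hG 1; have h2 := hG 2
    simp only [Matrix.cons_val_zero, Matrix.cons_val_one, Matrix.head_cons, Matrix.cons_val_two,
      Matrix.tail_cons] at h0 h1 h2
    have hu := hmem 0; have hv := hmem 1
    simp only [Matrix.cons_val_zero, Matrix.cons_val_one] at hu hv
    rw [← h2, hh.map_mul hu hv, h0, h1]
  have hexp : ∀ u, G (exp u) = exp (G u) := by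
    intro u
    obtain ⟨h, T, T', hh, -, -, hmem, hG⟩ := hpair ![u, exp u]
    have h0 := hG 0; have h1 := hG 1
    simp only [Matrix.cons_val_zero, Matrix.cons_val_one] at h0 h1
    have hu := hmem 0
    simp only [Matrix.cons_val_zero] at hu
    rw [← h1, hh.map_exp hu, h0]
  have hinj : Function.Injective G := by
    intro u v huv
    obtain ⟨h, T, T', hh, -, -, hmem, hG⟩ := hpair ![u, v]
    have h0 := hG 0; have h1 := hG 1
    simp only [Matrix.cons_val_zero, Matrix.cons_val_one] at h0 h1
    have hu := hmem 0; have hv := hmem 1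
    simp only [Matrix.cons_val_zero, Matrix.cons_val_one] at hu hv
    exact hh.bijOn.injOn hu hv (by rw [h0, h1, huv])
  have hsurj' : Function.Surjective G := fun z => by
    have : z ∈ G '' univ := by rw [himg]; exact mem_univ z
    obtain ⟨w, -, hw⟩ := this
    exact ⟨w, hw⟩
  have hzero : G 0 = 0 := by
    have := hadd 0 0
    rw [add_zero] at this
    -- `G 0 = G 0 + G 0`
    have h2 : G 0 + G 0 = G 0 + 0 := by rw [add_zero]; exact this.symm
    exact add_left_cancel h2
  have hone : G 1 = 1 := by
    have h11 := hmul 1 1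
    rw [mul_one] at h11
    by_cases h10 : G 1 = 0
    · exact absurd (hinj (h10.trans hzero.symm)) one_ne_zero
    · exact mul_left_cancel₀ h10 (h11.symm.trans (mul_one (G 1)).symm)
  let f : K →+* K :=
    { toFun := G, map_one' := hone, map_mul' := hmul, map_zero' := hzero, map_add' := hadd }
  let e : K ≃+* K := RingEquiv.ofBijective f ⟨hinj, hsurj'⟩
  refine ⟨⟨e, fun u => ?_⟩, fun z hz => ?_⟩
  · change e (exp u) = exp (e u)
    rw [RingEquiv.ofBijective_apply, RingEquiv.ofBijective_apply]
    exact hexp u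
  · change e z = g z
    rw [RingEquiv.ofBijective_apply]
    change G z = g z
    obtain ⟨h, T, T', hh, hhg, hsub, hmem, hG⟩ := hpair ![z]
    have h0 := hG 0
    have hz0 := hmem 0
    simp only [Matrix.cons_val_zero] at h0 hz0
    rw [← h0]
    exact hhg hz

end ZilberHomogeneity

end Literature.NumberTheory.Transcendental
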